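import Summits.Langlands.Langlands.Theses.OrdinaryPrimeTransport
import Summits.Langlands.Langlands.Theorems.BaseFieldAscentReciprocityTRCMPotentialAutomorphyCMTightness
import Literature.NumberTheory.Automorphic.Qian2022PotentialAutomorphy
import Literature.NumberTheory.Automorphic.ACCAutomorphyLiftingCrystalline
import Literature.NumberTheory.GaloisRepresentations.CrystallineOrdinary
import Literature.NumberTheory.GaloisRepresentations.LabelledHodgeTateWeights
import Literature.NumberTheory.GaloisRepresentations.CrystallineDeformationRing
import Literature.NumberTheory.GaloisRepresentations.RestrictFieldSelf
import HarnessLib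

/-!
# F4 ON-PATH LEMMA — line `FontaineLaffaillePotentialAutomorphyCM` (crux `ReciprocityUpToIrreducibility`, item stmt-Langlands-14328)
# forward generator G4 ladder-down, generation 30 — `Langlands → rung` PROVED (0 sorry)

`FontaineLaffaillePotentialAutomorphyCM_of_Langlands : Langlands → FontaineLaffaillePotentialAutomorphyCM`: clause (B)
of the summit over the CM field `K` itself, for the reciprocity datum the summit provides, gives an L-algebraic
cuspidal `π` with `Corresponds Rec ι π r`, whose first component is a.e. Satake–Frobenius compatibility; take
`K' := K` (`IsGalois.self`, landed `ReciprocityTRCM.satakeFrobCompatibleAt_restrictField_self`).  Every cell of the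
family is de Rham for the PINNED datum `fontainePstAdicCompletion v ℓ hv = Rec.pst ℓ v hv` (`rfl`), which is what
makes the on-path proof five lines (Disproof.lean §B honoured).  Also `potAutCM_of_top : E → PotAutCM θ`.
This file is self-contained (same definitions as the skeleton's §1 and §4, namespace suffix `.OnPath`).
-/

noncomputable section

set_option linter.dupNamespace false

open scoped MatrixGroups Matrix NumberField Classical TensorProduct
open Filter IsDedekindDomain Field
open Literature.NumberTheory.Automorphic Literature.NumberTheory.GaloisRepresentations
open Literature.NumberTheory.PAdicHodge
open Summit.Langlands

namespace Summit.Langlands.Langlands.Cruxes.ReciprocityUpToIrreducibility.FontaineLaffaillePotentialAutomorphyCM.OnPath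

/-! ## 1. The graded local clause and the family -/

section Clauses

variable (K : Type) [Field K] [NumberField K] (ℓ : ℕ) [Fact ℓ.Prime] {n : ℕ}
  (r : FramedGaloisRep K (PadicAlgCl ℓ) n) (v : HeightOneSpectrum (𝓞 K)) (hv : ((ℓ : ℕ) : 𝓞 K) ∈ v.asIdeal)

/-- Cell θ = 0 at `v ∣ ℓ` (FLOOR, Qian 2023 Thm. 1.4 / Def. 1.2 in the crystalline-ordinary case): de Rham for
the pinned Fontaine datum and crystalline-ordinary with strictly decreasing cyclotomic exponents. -/
def OrdClause : Prop :=
  (fontainePstAdicCompletion v ℓ hv).IsDeRhamFramed (r.toLocal v) ∧ r.IsCrystallineOrdinaryAt ℓ v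

/-- Cell θ = 1 at `v ∣ ℓ` (the consecutive-weight Fontaine–Laffaille cell of route `StickelbergerDial`,
`WeightZeroNonOrdinaryPA`): `ℓ` unramified in `K`, `r|_{Γ_{K_v}}` crystalline for the pinned datum, labelled
Hodge–Tate weights `{0, …, n-1}` at every `ℚ_ℓ`-label. -/
def FLConsecutiveClause : Prop :=
  Algebra.IsUnramifiedIn (𝓞 K) (Ideal.span {(ℓ : ℤ)}) ∧
    (let D := fontainePstAdicCompletion v ℓ hv
     D.IsCrystallineFramed (r.toLocal v) ∧
       (letI := D.algebra
        ∀ τ' : v.adicCompletion K →ₐ[ℚ_[ℓ]] PadicAlgCl ℓ,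
          r.labelledHodgeTateWeightsAt v D.algebra D.𝔅 τ'.toRingHom = (Multiset.range n).map fun i : ℕ => (i : ℤ)))

/-- Cell θ = 2 at `v ∣ ℓ` (THE RUNG's clause, Fontaine–Laffaille of ARBITRARY regular weight): `ℓ` unramified
in `K`, `r|_{Γ_{K_v}}` crystalline for the pinned datum, labelled Hodge–Tate weights pairwise distinct and of
spread `≤ ℓ - 2` at every `ℚ_ℓ`-label. -/
def FLClause : Prop :=
  Algebra.IsUnramifiedIn (𝓞 K) (Ideal.span {(ℓ : ℤ)}) ∧
    (let D := fontainePstAdicCompletion v ℓ hv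
     D.IsCrystallineFramed (r.toLocal v) ∧
       (letI := D.algebra
        ∀ τ' : v.adicCompletion K →ₐ[ℚ_[ℓ]] PadicAlgCl ℓ,
          (r.labelledHodgeTateWeightsAt v D.algebra D.𝔅 τ'.toRingHom).Nodup ∧
            ∀ a ∈ r.labelledHodgeTateWeightsAt v D.algebra D.𝔅 τ'.toRingHom,
              ∀ b ∈ r.labelledHodgeTateWeightsAt v D.algebra D.𝔅 τ'.toRingHom, a - b ≤ (ℓ : ℤ) - 2))

/-- Cell θ = 3 at `v ∣ ℓ` (the whole regular sector): de Rham for the pinned datum with pairwise distinct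
labelled Hodge–Tate weights at every `ℚ_ℓ`-label. -/
def RegularClause : Prop :=
  let D := fontainePstAdicCompletion v ℓ hv
  D.IsDeRhamFramed (r.toLocal v) ∧
    (letI := D.algebra
     ∀ τ' : v.adicCompletion K →ₐ[ℚ_[ℓ]] PadicAlgCl ℓ,
       (r.labelledHodgeTateWeightsAt v D.algebra D.𝔅 τ'.toRingHom).Nodup)

/-- **The graded local clause** (cumulative disjunction, so monotone in θ by construction). -/
def LocalClause (θ : ℕ) : Prop :=
  OrdClause K ℓ r v hv ∨ (1 ≤ θ ∧ FLConsecutiveClause K ℓ r v hv) ∨ (2 ≤ θ ∧ FLClause K ℓ r v hv) ∨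
    (3 ≤ θ ∧ RegularClause K ℓ r v hv)

variable {K ℓ r v hv}

theorem localClause_mono {θ θ' : ℕ} (hθ : θ ≤ θ') (h : LocalClause K ℓ r v hv θ) :
    LocalClause K ℓ r v hv θ' := by
  rcases h with h | ⟨h1, h⟩ | ⟨h2, h⟩ | ⟨h3, h⟩
  · exact Or.inl h
  · exact Or.inr (Or.inl ⟨h1.trans hθ, h⟩)
  · exact Or.inr (Or.inr (Or.inl ⟨h2.trans hθ, h⟩))
  · exact Or.inr (Or.inr (Or.inr ⟨h3.trans hθ, h⟩))

/-- Every cell is de Rham for the pinned datum (crystalline ⇒ de Rham, `IsCrystallineFramed.isDeRhamFramed`). -/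
theorem isDeRhamFramed_of_localClause {θ : ℕ} (h : LocalClause K ℓ r v hv θ) :
    (fontainePstAdicCompletion v ℓ hv).IsDeRhamFramed (r.toLocal v) := by
  rcases h with h | ⟨-, h⟩ | ⟨-, h⟩ | ⟨-, h⟩
  · exact h.1
  · exact h.2.1.isDeRhamFramed
  · exact h.2.1.isDeRhamFramed
  · exact h.1

end Clauses

/-- The residual hypotheses of Qian 2023 Thm. 1.4 = ACC+ Thm. 6.1.1 (3)–(4), on a residual representation
`τ` of `r` (`𝔽̄_ℓ`-coefficients): absolutely irreducible, decomposed generic, `τ|_{Γ_{K(ζ_ℓ)}}` absolutely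
irreducible with enormous image, and a scalar `τ σ` for some `σ ∉ Γ_{K(ζ_ℓ)}`. -/
def ResidualHyp (K : Type) [Field K] [NumberField K] (ℓ : ℕ) [Fact ℓ.Prime] {n : ℕ}
    (r : FramedGaloisRep K (PadicAlgCl ℓ) n)
    (τ : absoluteGaloisGroup K →* GL (Fin n) (padicAlgClResidueField ℓ)) : Prop :=
  r.IsResidualRepOf (RingHom.id _) τ ∧ IsAbsIrreducible τ ∧ IsDecomposedGeneric τ ∧
    IsAbsIrreducible (τ.comp (absGaloisGroupAdjoinRootsOfUnity K ℓ).subtype) ∧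
    Subgroup.IsEnormous ((absGaloisGroupAdjoinRootsOfUnity K ℓ).map τ) ∧
    ∃ σ : absoluteGaloisGroup K, σ ∉ absGaloisGroupAdjoinRootsOfUnity K ℓ ∧
      ∃ c : padicAlgClResidueField ℓ, (τ σ).1 = c • 1

/-- **Potential weak automorphy over a CM Galois extension** (the common conclusion of every cell): a number
field `K' ⊇ K`, Galois over `K` and CM, and an L-algebraic cuspidal `π'` of `GL_n(𝔸_{K'})` Satake–Frobenius
compatible with `r|_{Γ_{K'}}` at all but finitely many places. -/
def PotentiallyWeaklyAutomorphicCM (K : Type) [Field K] [NumberField K] (ℓ : ℕ) [Fact ℓ.Prime] {n : ℕ}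
    (ι : PadicAlgCl ℓ ≃+* ℂ) (r : FramedGaloisRep K (PadicAlgCl ℓ) n) : Prop :=
  ∃ (K' : Type) (_ : Field K') (_ : NumberField K') (_ : Algebra K K') (_ : IsGalois K K'),
    NumberField.IsCMField K' ∧
      ∃ (hcpt' : isCompact_glFiniteIntegralLevel n K') (π' : CuspidalAutomorphicRepData n K' hcpt'),
        π'.1.IsLAlgebraic ∧
          ∀ᶠ w : HeightOneSpectrum (𝓞 K') in cofinite, SatakeFrobCompatibleAt ι π'.1 (r.restrictField K') w

/-- The family over an arbitrary hypothesis `H` on `(K, ℓ, r)` (used for the cells and their complements). -/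
def PotAutCMOn
    (H : ∀ (K : Type) [Field K] [NumberField K] (ℓ : ℕ) [Fact ℓ.Prime] (n : ℕ),
      FramedGaloisRep K (PadicAlgCl ℓ) n → Prop) : Prop :=
  ∀ (K : Type) [Field K] [NumberField K], NumberField.IsCMField K →
    ∀ (n : ℕ), 2 ≤ n →
    ∀ (ℓ : ℕ) [Fact ℓ.Prime] (ι : PadicAlgCl ℓ ≃+* ℂ) (r : FramedGaloisRep K (PadicAlgCl ℓ) n)
      (τ : absoluteGaloisGroup K →* GL (Fin n) (padicAlgClResidueField ℓ)),
      r.toGaloisRep.IsIrreducible →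
      (∀ᶠ v : HeightOneSpectrum (𝓞 K) in cofinite, r.IsUnramifiedAt v) →
      H K ℓ n r → ResidualHyp K ℓ r τ → PotentiallyWeaklyAutomorphicCM K ℓ ι r

/-- The hypothesis of cell θ: the graded local clause at EVERY `v ∣ ℓ`. -/
def CellHyp (θ : ℕ) (K : Type) [Field K] [NumberField K] (ℓ : ℕ) [Fact ℓ.Prime] (n : ℕ)
    (r : FramedGaloisRep K (PadicAlgCl ℓ) n) : Prop :=
  ∀ (v : HeightOneSpectrum (𝓞 K)) (hv : ((ℓ : ℕ) : 𝓞 K) ∈ v.asIdeal), LocalClause K ℓ r v hv θ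

/-- **THE FAMILY** `PotAutCM θ`: single-representation potential weak automorphy over CM fields for irreducible
`r` with big residual image whose local type at every `v ∣ ℓ` lies in cell θ. -/
def PotAutCM (θ : ℕ) : Prop :=
  PotAutCMOn (CellHyp θ)

/-- **THE RUNG (crux #1 of the ladder)**: `PotAutCM 2` — Fontaine–Laffaille crystalline of ARBITRARY regular
weight (or crystalline-ordinary) at every `v ∣ ℓ`, `ℓ` unramified in the CM field `K`, no self-duality. -/
def FontaineLaffaillePotentialAutomorphyCM : Prop :=
  PotAutCM 2

/-! ## 4. On-path (F4): the summit, and the top E, give every cell with `K' := K` -/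

/-- Weak automorphy over `K` itself is potential weak automorphy over the CM Galois extension `K' := K`
(`Algebra.id`, `IsGalois.self`; `r|_{Γ_K}` along `K ≤ K` is a change of frame, landed
`ReciprocityTRCM.satakeFrobCompatibleAt_restrictField_self`). [folklore] -/
theorem potentiallyWeaklyAutomorphicCM_self {K : Type} [Field K] [NumberField K] (hK : NumberField.IsCMField K)
    {ℓ : ℕ} [Fact ℓ.Prime] {n : ℕ} (ι : PadicAlgCl ℓ ≃+* ℂ) (r : FramedGaloisRep K (PadicAlgCl ℓ) n)
    {hcpt : isCompact_glFiniteIntegralLevel n K} (π : CuspidalAutomorphicRepData n K hcpt)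
    (hL : π.1.IsLAlgebraic)
    (hsat : ∀ᶠ v : HeightOneSpectrum (𝓞 K) in cofinite, SatakeFrobCompatibleAt ι π.1 r v) :
    PotentiallyWeaklyAutomorphicCM K ℓ ι r :=
  ⟨K, inferInstance, inferInstance, inferInstance, IsGalois.self K, hK, hcpt, π, hL,
    hsat.mono fun _ hv => Theorems.ReciprocityTRCM.satakeFrobCompatibleAt_restrictField_self ι π.1 hv⟩

/-- Clause (B) (Galois → automorphic) over the CM field `K` for ONE reciprocity datum gives the family's
conclusion for every `r` in any cell (each cell is de Rham for the pinned datum = `Rec.pst` by `rfl`). -/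
theorem potAutCMOn_of_galoisToAutomorphic
    (H : ∀ (K : Type) [Field K] [NumberField K] (ℓ : ℕ) [Fact ℓ.Prime] (n : ℕ),
      FramedGaloisRep K (PadicAlgCl ℓ) n → Prop)
    (hdR : ∀ (K : Type) [Field K] [NumberField K] (ℓ : ℕ) [Fact ℓ.Prime] (n : ℕ)
      (r : FramedGaloisRep K (PadicAlgCl ℓ) n), H K ℓ n r →
        ∀ (v : HeightOneSpectrum (𝓞 K)) (hv : ((ℓ : ℕ) : 𝓞 K) ∈ v.asIdeal),
          (fontainePstAdicCompletion v ℓ hv).IsDeRhamFramed (r.toLocal v))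
    (hB : ∀ (K : Type) [Field K] [NumberField K], NumberField.IsCMField K →
      ∃ Rec : ReciprocityData K, ∀ n : ℕ, 0 < n →
        ∀ hcpt : isCompact_glFiniteIntegralLevel n K, GaloisToAutomorphic n Rec hcpt) :
    PotAutCMOn H := by
  intro K _ _ hK n hn ℓ _ ι r τ hirr hur hH _hres
  obtain ⟨Rec, hall⟩ := hB K hK
  have hgeo : IsGeometricFramed Rec r := ⟨hur, fun v hv => hdR K ℓ n r hH v hv⟩
  obtain ⟨π, hLalg, hcorr⟩ :=
    hall n (by omega) (isCompact_glFiniteIntegralLevel_holds n K) ℓ ι r hirr hgeo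
  exact potentiallyWeaklyAutomorphicCM_self hK ι r π hLalg hcorr.1

/-- `Langlands → PotAutCM θ` for every θ. -/
theorem potAutCM_of_langlands (θ : ℕ) (hL : _root_.Langlands) : PotAutCM θ :=
  potAutCMOn_of_galoisToAutomorphic _ (fun _ _ _ _ _ _ _ hH v hv => isDeRhamFramed_of_localClause (hH v hv))
    fun K _ _ _ => by
      obtain ⟨⟨Rec⟩, hall⟩ := hL K
      exact ⟨Rec, fun n hn hcpt => (hall Rec n hn hcpt).2⟩

/-- **F4 ON-PATH LEMMA for the rung**: `Langlands → FontaineLaffaillePotentialAutomorphyCM`. -/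
@[aesop safe apply]
theorem FontaineLaffaillePotentialAutomorphyCM_of_Langlands (hL : _root_.Langlands) :
    FontaineLaffaillePotentialAutomorphyCM :=
  potAutCM_of_langlands 2 hL

/-- `E → PotAutCM θ` (clause (B) of E for its own `Rec`). -/
theorem potAutCM_of_top (θ : ℕ)
    (hE : Summit.Langlands.Langlands.Theses.OrdinaryPrimeTransport.ReciprocityUpToIrreducibility) :
    PotAutCM θ :=
  potAutCMOn_of_galoisToAutomorphic _ (fun _ _ _ _ _ _ _ hH v hv => isDeRhamFramed_of_localClause (hH v hv))
    fun K _ _ _ => by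
      obtain ⟨Rec, hall⟩ := hE K
      exact ⟨Rec, fun n hn hcpt => (hall n hn hcpt).2⟩

/-- `E → rung`. -/
theorem FontaineLaffaillePotentialAutomorphyCM_of_top
    (hE : Summit.Langlands.Langlands.Theses.OrdinaryPrimeTransport.ReciprocityUpToIrreducibility) :
    FontaineLaffaillePotentialAutomorphyCM :=
  potAutCM_of_top 2 hE


end Summit.Langlands.Langlands.Cruxes.ReciprocityUpToIrreducibility.FontaineLaffaillePotentialAutomorphyCM.OnPath

end
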